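import Summits.SmoothPoincare4.SmoothPoincare4.Theses.EntropyRung

/-!
# Line `spineless-models` — crux `EntropyRung.SubcylindricalRecognition` (stmt-SmoothPoincare4-10869, "RUNG")

crux-plan round 1 · planner-cruxplan-stmt-SmoothPoincare4-10869-spineless-models-0 · idea card
`Cruxes/SubcylindricalRecognition/Ideas/spineless-models.md` (triage r1: pass ×3; sharpenings of r1-1/2/3 applied) ·
line card `Lines/spineless-models.md` · `lean check` rc 0, sorries only in the four `stub_*`; `ledger skeleton check` appends
`#h21_check_skeleton` below `end`.

THE LINE. Every singularity model of the Ricci flow of `(M, g)` is delivered together with smooth embeddings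
into `M` of each relatively compact open piece of it (Cheeger–Gromov exhaustion maps: Mantegazza–Müller
arXiv:1205.4143 Thm 1.4 for Type-I blow-ups; Bamler arXiv:2009.03243 §2.10 / BCDMZ arXiv:2102.04649 Thm 2 for
tangent flows, smooth convergence off the conical points). With `M ≃ₕ S⁴` this is a TOPOLOGICAL SIEVE on the
shrinker zoo, complementary to the entropy sieve; composed with the END-DENSITY CEILING (card end-density-ceiling,
triage merge advice) RUNG needs the non-compact density gap (route item #2 `NoncompactShrinkerGap`, stmt-…-10868)
only in two strictly weaker pieces: on the Munteanu–Wang class `0 < c ≤ R ≤ C` (`stub_gapPinched`, theorem-grade: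
every end is a quotient neck or a bubble sheet) and, OUTSIDE that class, only for shrinkers that EXHAUST INTO A
HOMOTOPY 4-SPHERE (`stub_gapResidual` — the line's crux: asymptotically conical / MW-residual / unbounded-R
non-Kähler shrinkers on S⁴-embeddable open 4-manifolds, cone links forced to embed in a homotopy S⁴).

    RUNG ⇐ stub_modelDelivery           extraction INTERFACE: a smooth complete connected non-flat normalised
                                         shrinker N with ∫e^{-f} > 32π²√π e^{-3/2}, exhausting into M (known modulo
                                         vendoring Perelman (T2) + Hamilton/MM compactness + Bamler–BCDMZ Thm 2; XL;
                                         the socket into which an extraction line — type-split / ancient-sphere —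
                                         plugs: both export the exhaustion maps for free)
         ∧ stub_gapPinched              #2 on the MW class 0 < c ≤ R ≤ C (MW 1606.01861 Thm 1.3/1.5 ∘ ceiling; L)
         ∧ stub_gapResidual             #2 off the MW class, for shrinkers exhausting into a homotopy S⁴ (OPEN)
         ∧ CompactShrinkerGap           route item #4 (stmt-…-10870), taken BY NAME as a hypothesis
         ∧ stub_compactModelRecognition injective immersion of a closed 4-manifold into a connected one is a
                                         diffeomorphism (classical; M).

COMPOSITION. `composition_holds : Composition` (hypothesis form, SORRY-FREE, axioms ⊆ {propext, Classical.choice,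
Quot.sound}): deliver N; if N is compact, the exhaustion map of K = N is an injective immersion N → M, hence a
diffeomorphism (M is path connected, being ≃ₕ S⁴ — tree lemma `pathConnectedSpace_of_homotopyEquiv`), so N ≃ₕ S⁴
carries a dense compact shrinker and #4 gives N ≃ₘ S⁴, whence M ≃ₘ S⁴; if N is non-compact, `stub_gapPinched` (R
pinched) or `stub_gapResidual` with X := M (otherwise) contradicts the density floor. SKELETON THEOREM (A12 shape):
`SubcylindricalRecognition_of (hCpt : EntropyRung.CompactShrinkerGap) : EntropyRung.SubcylindricalRecognition :=
composition_holds stub_modelDelivery stub_gapPinched stub_gapResidual hCpt stub_compactModelRecognition` — concludes the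
crux BY NAME, hypotheses = registered obligations only. Certificates (sorry-free): `sectors_of_noncompactShrinkerGap`
(#2 ⇒ both gap stubs: the line is NO HARDER than the route's plan), `embeddableGap_of_sectors`, `routeComposition_holds`.

DISPROOF USED (cdisprove cycle 1 final, evidence 20260815T225702Z-Disproof.lean, read through its evidence notes —
the evidence store is not mounted in planner jails): `false_without_homotopyEquiv` is honoured — `M ≃ₕ S⁴` is used
three times (X := M in `stub_gapResidual`; connectedness of M for `stub_compactModelRecognition`; N ≃ₕ S⁴ for #4),
and `stub_modelDelivery`, `stub_gapPinched` are deliberately stated WITHOUT it; `spc4_imp` / `iff_exoticFree`: no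
stub restates RUNG or SPC4 (the stubs conclude: existence of a model; two integral inequalities on abstract
non-compact shrinkers; a diffeo N ≃ₘ M between abstract manifolds); the certified window arithmetic
`thetaS2R2_lt_thetaCyl` (e < π), `thetaCyl_lt_thetaSph` (πe < 9) and kit j006074 (Θ(BCCD) = .5617) settle the
Kähler sector of both gap stubs. No `Theorems/SubcylindricalRecognition/Negative/` lemma has landed (nothing to
import or check stubs against); `ledger negatives --problem SmoothPoincare4` = 0.
-/

namespace Summit.SmoothPoincare4.SmoothPoincare4.Cruxes.SubcylindricalRecognition.SpinelessModels

open scoped BigOperators Topology Manifold Classical MeasureTheory Matrix InnerProductSpace ContinuousMap ContDiff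
open Filter Set Function TopologicalSpace MeasureTheory
open Summit.SmoothPoincare4.SmoothPoincare4.Theses.EntropyRung

/-- `ExhaustsInto N X`: every relatively compact open piece `K` of the 4-manifold `N` is carried into `X` by a map
that is `C^∞`, injective and immersive ON `K` (a Cheeger–Gromov exhaustion map `φ_j : U_j → X`, extended by junk
off `K`). Deliberately piecewise — no coherence between the maps for different `K` (triage r1-2 sharpening): the
sieve only ever looks at one piece (a tubular neighbourhood of a surface, of a 3-manifold, of an end's cross-section)
at a time. In equal dimension an injective immersion on an open set is an open embedding, so nothing is lost
against `Manifold.IsSmoothEmbedding` of `K`. Reflexive and transitive; `ExhaustsInto N ∅` is false for `N ≠ ∅`.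
(Cheeger–Gromov convergence, Hamilton 1995 compactness, Def. 1.2.) [folklore] -/
@[folklore] def ExhaustsInto (N X : Type) [TopologicalSpace N] [ChartedSpace (EuclideanSpace ℝ (Fin 4)) N]
    [TopologicalSpace X] [ChartedSpace (EuclideanSpace ℝ (Fin 4)) X] : Prop :=
  ∀ K : Set N, IsOpen K → IsCompact (closure K) →
    ∃ φ : N → X, ContMDiffOn (𝓡 4) (𝓡 4) ∞ φ K ∧ Set.InjOn φ K ∧
      ∀ x ∈ K, Function.Injective (mfderiv (𝓡 4) (𝓡 4) φ x)

/-! ## Registered stubs (4) -/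

/-- **stub_modelDelivery** — EXTRACTION INTERFACE (known modulo vendoring; XL). For a closed connected Riemannian
4-manifold with `R > 0` and `ν(g) > ν_cyl` (typed exactly as in RUNG, but WITHOUT the homotopy-sphere hypothesis):
the Ricci flow is singular at some `T ≤ 2/R_min` (tree: `ricciFlow_maximal_existence`, `ricciFlow_curvature_blowup`,
Hamilton 1982 / Topping 2006 Thm 5.3.1); blow up by Hamilton point picking + Perelman no-local-collapsing from the
μ-floor (tree: `perelman_noLocalCollapsing_of_muMonotone_of_muLowerBound`) to a complete bounded-curvature
singularity model `M_∞` CG-exhausting into `M` (Hamilton 1995 compactness); its tangent flow at `−∞` (BCDMZ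
arXiv:2102.04649 Thm 2, an 𝔽-limit of the COMPACT flow, p. 5; Bamler arXiv:2009.03243 §2.10) — or, at a Type-I
time, directly the Mantegazza–Müller blow-up (arXiv:1205.4143 Thm 1.4–1.6) — is a complete 4-d orbifold gradient
shrinker `N` with `log Θ(N) = lim 𝒩 ≥ μ ≥ ν(g) ≥ ν_cyl + δ` (Perelman monotonicity; transplanting compactly
supported test functions), hence `Θ(N) > Θ(S³×ℝ) > 1/2`, so `N` has NO orbifold point (`Θ(N) ≤ 1/|Γ|` by
Nash-entropy monotonicity on `N`'s own flow) and is smooth; it is non-flat (ε-regularity at the blow-up centre),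
normalised `Ric + Hess f = g/2`, `R + |∇f|² = f`, so `∫ e^{-f} = 16π² Θ(N) ≥ 16π² e^{ν_cyl+δ} > 32π²√π e^{-3/2}`
(Carrillo–Ni 2009 / Li–Wang 2019 (2.5)); and `N` (= its regular part) exhausts into `M_∞` (Bamler: 𝔽-convergence
is smooth on the regular part), hence into `M`. Output in the currency of route items #2/#4. The extraction stubs of
lines type-split-bryant-ceiling / ancient-sphere-rigidity prove this verbatim once they export the exhaustion maps
they construct anyway. -/
theorem stub_modelDelivery :
    ∀ (M : Type) [TopologicalSpace M] [T2Space M] [SecondCountableTopology M] [ChartedSpace (EuclideanSpace ℝ (Fin 4)) M] [IsManifold (𝓡 4) ∞ M] [CompactSpace M] [ConnectedSpace M] [T3Space M] [MeasurableSpace M] [BorelSpace M]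
    (g : Literature.Geometry.Lorentzian.PseudoRiemannianMetric (𝓡 4) ∞ (EuclideanSpace ℝ (Fin 4)) (TangentSpace (𝓡 4) : M → Type _)) [g.HasLeviCivita] (hg : g.IsRiemannian),
    (∀ x : M, 0 < g.scalarCurvature x) →
    (∃ δ : ℝ, 0 < δ ∧ ∀ τ : ℝ, 0 < τ → ∀ f : M → ℝ, ContMDiff (𝓡 4) 𝓘(ℝ, ℝ) ∞ f → ∫ x, (4 * Real.pi * τ) ^ (-(4 : ℝ) / 2) * Real.exp (-f x) ∂(Literature.Geometry.Lorentzian.riemannianMeasure (g.toContMDiffRiemannianMetric hg)) = 1 → Real.log 2 + Real.log Real.pi / 2 - 3 / 2 + δ ≤ ∫ x, (τ * (g.scalarCurvature x + g.gradSq f x) + f x - 4) * ((4 * Real.pi * τ) ^ (-(4 : ℝ) / 2) * Real.exp (-f x)) ∂(Literature.Geometry.Lorentzian.riemannianMeasure (g.toContMDiffRiemannianMetric hg))) →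
    ∃ (N : Type) (_ : TopologicalSpace N) (_ : T2Space N) (_ : SecondCountableTopology N)
    (_ : ChartedSpace (EuclideanSpace ℝ (Fin 4)) N) (_ : IsManifold (𝓡 4) ∞ N) (_ : ConnectedSpace N)
    (_ : T3Space N) (_ : MeasurableSpace N) (_ : BorelSpace N)
    (gN : Literature.Geometry.Lorentzian.PseudoRiemannianMetric (𝓡 4) ∞ (EuclideanSpace ℝ (Fin 4)) (TangentSpace (𝓡 4) : N → Type _)) (_ : gN.HasLeviCivita) (fN : N → ℝ) (hgN : gN.IsRiemannian),
    (∀ (x : N) (r : NNReal), IsCompact {y : N | gN.edist hgN x y ≤ r}) ∧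
    ContMDiff (𝓡 4) 𝓘(ℝ, ℝ) ∞ fN ∧
    (∀ (x : N) (X Y : TangentSpace (𝓡 4) x), gN.ricci x X Y + gN.hessian fN x X Y = (1 / 2 : ℝ) * gN.val x X Y) ∧
    (∀ x : N, gN.scalarCurvature x + gN.gradSq fN x = fN x) ∧
    (∃ x : N, gN.scalarCurvature x ≠ 0) ∧
    ENNReal.ofReal (32 * Real.pi ^ 2 * Real.sqrt Real.pi * Real.exp (-(3 : ℝ) / 2)) < ∫⁻ x, ENNReal.ofReal (Real.exp (-fN x)) ∂(Literature.Geometry.Lorentzian.riemannianMeasure (gN.toContMDiffRiemannianMetric hgN)) ∧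
    ExhaustsInto N M := by
  sorry

/-- **stub_gapPinched** — route item #2 `NoncompactShrinkerGap` on the MUNTEANU–WANG CLASS (theorem-grade; L).
A complete connected non-compact normalised 4-d gradient shrinker with `0 < c ≤ R ≤ C` has `∫ e^{-f} dV ≤ 32π²√π
e^{-3/2}` (`Θ ≤ Θ(S³×ℝ)`): bounded `R` ⇒ bounded `Rm` (Munteanu–Wang arXiv:1606.01861 Thm 1.3); `R ≥ c > 0` on an
end ⇒ the end is smoothly asymptotic to `ℝ × S³/Γ` or converges to `ℝ² × S²` (or its ℤ₂-quotient) along every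
integral curve of `∇f` (MW Thm 1.5); END-DENSITY CEILING `Θ(N) ≤ Θ(E)` (card end-density-ceiling: basepoint-free
`lim_τ 𝒩 = log Θ(N)`, Chan–Ma–Zhang arXiv:2106.06904 Thm 1.1/Cor 1.2, + locality of `𝒩` far out on the end, or
μ-upper-semicontinuity by transplanting the end model's minimiser) ⇒ `Θ(N) ≤ max(Θ(S³)/|Γ|, 2/e) ≤ Θ(S³×ℝ)`
(equality only for `S³×ℝ`; `2/e < Θ_cyl ⟺ e < π`, Disproof `thetaS2R2_lt_thetaCyl`). No embeddability
hypothesis: the sieve is idle in this sector (same statement as end-density-ceiling's first lemma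
`NoncompactGapPositiveScalar`, in the route's fact-free spelling — one proof serves both lines). -/
theorem stub_gapPinched :
    ∀ (M : Type) [TopologicalSpace M] [T2Space M] [SecondCountableTopology M] [ChartedSpace (EuclideanSpace ℝ (Fin 4)) M] [IsManifold (𝓡 4) ∞ M] [ConnectedSpace M] [NoncompactSpace M] [T3Space M] [MeasurableSpace M] [BorelSpace M]
    (g : Literature.Geometry.Lorentzian.PseudoRiemannianMetric (𝓡 4) ∞ (EuclideanSpace ℝ (Fin 4)) (TangentSpace (𝓡 4) : M → Type _)) [g.HasLeviCivita] (f : M → ℝ) (hg : g.IsRiemannian),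
    (∀ (x : M) (r : NNReal), IsCompact {y : M | g.edist hg x y ≤ r}) → ContMDiff (𝓡 4) 𝓘(ℝ, ℝ) ∞ f →
    (∀ (x : M) (X Y : TangentSpace (𝓡 4) x), g.ricci x X Y + g.hessian f x X Y = (1 / 2 : ℝ) * g.val x X Y) →
    (∀ x : M, g.scalarCurvature x + g.gradSq f x = f x) →
    (∃ c C : ℝ, 0 < c ∧ ∀ x : M, c ≤ g.scalarCurvature x ∧ g.scalarCurvature x ≤ C) →
    ∫⁻ x, ENNReal.ofReal (Real.exp (-f x)) ∂(Literature.Geometry.Lorentzian.riemannianMeasure (g.toContMDiffRiemannianMetric hg)) ≤ ENNReal.ofReal (32 * Real.pi ^ 2 * Real.sqrt Real.pi * Real.exp (-(3 : ℝ) / 2)) := by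
  sorry

/-- **stub_gapResidual** — THE LINE'S CRUX (open). Route item #2 VERBATIM, OFF the Munteanu–Wang class (`inf R = 0`
or `sup R = ∞`: asymptotically conical ends, MW Thm 1.4 / Kotschwar–Wang 2015 cone rigidity; MW's open mixed
dichotomy; unbounded curvature) and under ONE EXTRA HYPOTHESIS: the shrinker exhausts into some closed smooth
homotopy 4-sphere `X`. What the sieve removes here: every model containing an embedded ORIENTED closed surface of
non-zero self-intersection (H₂(X) = 0, tree: `Literature.Barriers.SmoothPoincare4.isZero_singularHomologyZ_two_of_homotopyEquiv`;
oriented only — ℝP² ⊂ S⁴ has normal Euler number ±2): FIK on O(−1), BCCD on Bl₁(ℙ¹×ℂ), anything on O(k), k ≠ 0, or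
on punctured ±ℂP², S²×S², …; every model with a closed 3-manifold `Y ⊂ N` not embeddable in a homology 4-sphere —
in particular every conical end or neck with link S³/Γ, Γ ≠ 1 cyclic (Hantzsche 1938: Tor H₁(Y) ≅ A ⊕ A) or Γ a
non-cyclic spherical space-form group other than possibly Q₈ (Crisp–Hillman 1998); the whole Kähler sector is moot
anyway (Li–Wang arXiv:2301.09784 Thm 1.1 + kit j006074: Θ ≤ 2/e). RESIDUAL = non-Kähler shrinkers with `inf R = 0`
or unbounded `R` on S⁴-embeddable open 4-manifolds (ℝ⁴, S¹×ℝ³, S²×ℝ², ends S³×ℝ₊, (#ₖS¹×S²)×ℝ₊, T³×ℝ₊ …) with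
Θ ∈ (.791, 1): no example is known (rotationally symmetric sector empty, Kotschwar 2008; cohomogeneity-one /
U(2)-invariant non-Kähler sector: none found). `≤` admits S³×ℝ (pinched, not here) and is strict for nothing known. -/
theorem stub_gapResidual :
    ∀ (M : Type) [TopologicalSpace M] [T2Space M] [SecondCountableTopology M] [ChartedSpace (EuclideanSpace ℝ (Fin 4)) M] [IsManifold (𝓡 4) ∞ M] [ConnectedSpace M] [NoncompactSpace M] [T3Space M] [MeasurableSpace M] [BorelSpace M]
    (g : Literature.Geometry.Lorentzian.PseudoRiemannianMetric (𝓡 4) ∞ (EuclideanSpace ℝ (Fin 4)) (TangentSpace (𝓡 4) : M → Type _)) [g.HasLeviCivita] (f : M → ℝ) (hg : g.IsRiemannian),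
    (∀ (x : M) (r : NNReal), IsCompact {y : M | g.edist hg x y ≤ r}) → ContMDiff (𝓡 4) 𝓘(ℝ, ℝ) ∞ f →
    (∀ (x : M) (X Y : TangentSpace (𝓡 4) x), g.ricci x X Y + g.hessian f x X Y = (1 / 2 : ℝ) * g.val x X Y) →
    (∀ x : M, g.scalarCurvature x + g.gradSq f x = f x) → (∃ x : M, g.scalarCurvature x ≠ 0) →
    ¬ (∃ c C : ℝ, 0 < c ∧ ∀ x : M, c ≤ g.scalarCurvature x ∧ g.scalarCurvature x ≤ C) →
    (∃ (X : Type) (_ : TopologicalSpace X) (_ : T2Space X) (_ : SecondCountableTopology X)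
    (_ : ChartedSpace (EuclideanSpace ℝ (Fin 4)) X) (_ : IsManifold (𝓡 4) ∞ X) (_ : CompactSpace X),
    Nonempty (X ≃ₕ (Metric.sphere (0 : EuclideanSpace ℝ (Fin 5)) 1)) ∧ ExhaustsInto M X) →
    ∫⁻ x, ENNReal.ofReal (Real.exp (-f x)) ∂(Literature.Geometry.Lorentzian.riemannianMeasure (g.toContMDiffRiemannianMetric hg)) ≤ ENNReal.ofReal (32 * Real.pi ^ 2 * Real.sqrt Real.pi * Real.exp (-(3 : ℝ) / 2)) := by
  sorry

/-- **stub_compactModelRecognition** (classical differential topology; M). An injective `C^∞` immersion of a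
non-empty compact 4-manifold into a connected 4-manifold is a diffeomorphism onto it: immersions between
equidimensional manifolds are local diffeomorphisms (inverse function theorem in charts), so `φ` is open; `φ(N)` is
compact hence closed; `M` connected ⇒ `φ` surjective; a bijective local diffeomorphism is a diffeomorphism. This is
the step "compact smooth Cheeger–Gromov limit ⇒ M ≅ N" of Hamilton's compactness theorem, isolated as pure
topology (Lee, Introduction to Smooth Manifolds, 2nd ed., Thm 4.29 with Prop. 4.8 and Thm 4.14). [folklore] -/
theorem stub_compactModelRecognition :
    ∀ (N M : Type) [TopologicalSpace N] [T2Space N] [SecondCountableTopology N] [ChartedSpace (EuclideanSpace ℝ (Fin 4)) N] [IsManifold (𝓡 4) ∞ N] [CompactSpace N] [Nonempty N]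
    [TopologicalSpace M] [T2Space M] [SecondCountableTopology M] [ChartedSpace (EuclideanSpace ℝ (Fin 4)) M] [IsManifold (𝓡 4) ∞ M] [ConnectedSpace M]
    (φ : N → M), ContMDiff (𝓡 4) (𝓡 4) ∞ φ → Function.Injective φ →
    (∀ x : N, Function.Injective (mfderiv (𝓡 4) (𝓡 4) φ x)) →
    Nonempty (N ≃ₘ⟮𝓡 4, 𝓡 4⟯ M) := by
  sorry

/-! ## Composition (kernel-checked, no sorry) -/

/-- The line as ONE closed implication (hypothesis form): extraction ∧ pinched gap ∧ residual embeddable gap ∧ route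
item #4 ∧ compact-model recognition ⇒ RUNG. Proved below WITHOUT sorry (`composition_holds`, axioms ⊆ {propext,
Classical.choice, Quot.sound}); the audit-shaped skeleton theorem `SubcylindricalRecognition_of` instantiates it with the
four declared stubs and takes #4 by name. [folklore] -/
@[folklore] def Composition : Prop :=
    (∀ (M : Type) [TopologicalSpace M] [T2Space M] [SecondCountableTopology M] [ChartedSpace (EuclideanSpace ℝ (Fin 4)) M] [IsManifold (𝓡 4) ∞ M] [CompactSpace M] [ConnectedSpace M] [T3Space M] [MeasurableSpace M] [BorelSpace M]
      (g : Literature.Geometry.Lorentzian.PseudoRiemannianMetric (𝓡 4) ∞ (EuclideanSpace ℝ (Fin 4)) (TangentSpace (𝓡 4) : M → Type _)) [g.HasLeviCivita] (hg : g.IsRiemannian),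
      (∀ x : M, 0 < g.scalarCurvature x) →
      (∃ δ : ℝ, 0 < δ ∧ ∀ τ : ℝ, 0 < τ → ∀ f : M → ℝ, ContMDiff (𝓡 4) 𝓘(ℝ, ℝ) ∞ f → ∫ x, (4 * Real.pi * τ) ^ (-(4 : ℝ) / 2) * Real.exp (-f x) ∂(Literature.Geometry.Lorentzian.riemannianMeasure (g.toContMDiffRiemannianMetric hg)) = 1 → Real.log 2 + Real.log Real.pi / 2 - 3 / 2 + δ ≤ ∫ x, (τ * (g.scalarCurvature x + g.gradSq f x) + f x - 4) * ((4 * Real.pi * τ) ^ (-(4 : ℝ) / 2) * Real.exp (-f x)) ∂(Literature.Geometry.Lorentzian.riemannianMeasure (g.toContMDiffRiemannianMetric hg))) →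
      ∃ (N : Type) (_ : TopologicalSpace N) (_ : T2Space N) (_ : SecondCountableTopology N)
      (_ : ChartedSpace (EuclideanSpace ℝ (Fin 4)) N) (_ : IsManifold (𝓡 4) ∞ N) (_ : ConnectedSpace N)
      (_ : T3Space N) (_ : MeasurableSpace N) (_ : BorelSpace N)
      (gN : Literature.Geometry.Lorentzian.PseudoRiemannianMetric (𝓡 4) ∞ (EuclideanSpace ℝ (Fin 4)) (TangentSpace (𝓡 4) : N → Type _)) (_ : gN.HasLeviCivita) (fN : N → ℝ) (hgN : gN.IsRiemannian),
      (∀ (x : N) (r : NNReal), IsCompact {y : N | gN.edist hgN x y ≤ r}) ∧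
      ContMDiff (𝓡 4) 𝓘(ℝ, ℝ) ∞ fN ∧
      (∀ (x : N) (X Y : TangentSpace (𝓡 4) x), gN.ricci x X Y + gN.hessian fN x X Y = (1 / 2 : ℝ) * gN.val x X Y) ∧
      (∀ x : N, gN.scalarCurvature x + gN.gradSq fN x = fN x) ∧
      (∃ x : N, gN.scalarCurvature x ≠ 0) ∧
      ENNReal.ofReal (32 * Real.pi ^ 2 * Real.sqrt Real.pi * Real.exp (-(3 : ℝ) / 2)) < ∫⁻ x, ENNReal.ofReal (Real.exp (-fN x)) ∂(Literature.Geometry.Lorentzian.riemannianMeasure (gN.toContMDiffRiemannianMetric hgN)) ∧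
      ExhaustsInto N M) →
    (∀ (M : Type) [TopologicalSpace M] [T2Space M] [SecondCountableTopology M] [ChartedSpace (EuclideanSpace ℝ (Fin 4)) M] [IsManifold (𝓡 4) ∞ M] [ConnectedSpace M] [NoncompactSpace M] [T3Space M] [MeasurableSpace M] [BorelSpace M]
      (g : Literature.Geometry.Lorentzian.PseudoRiemannianMetric (𝓡 4) ∞ (EuclideanSpace ℝ (Fin 4)) (TangentSpace (𝓡 4) : M → Type _)) [g.HasLeviCivita] (f : M → ℝ) (hg : g.IsRiemannian),
      (∀ (x : M) (r : NNReal), IsCompact {y : M | g.edist hg x y ≤ r}) → ContMDiff (𝓡 4) 𝓘(ℝ, ℝ) ∞ f →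
      (∀ (x : M) (X Y : TangentSpace (𝓡 4) x), g.ricci x X Y + g.hessian f x X Y = (1 / 2 : ℝ) * g.val x X Y) →
      (∀ x : M, g.scalarCurvature x + g.gradSq f x = f x) →
      (∃ c C : ℝ, 0 < c ∧ ∀ x : M, c ≤ g.scalarCurvature x ∧ g.scalarCurvature x ≤ C) →
      ∫⁻ x, ENNReal.ofReal (Real.exp (-f x)) ∂(Literature.Geometry.Lorentzian.riemannianMeasure (g.toContMDiffRiemannianMetric hg)) ≤ ENNReal.ofReal (32 * Real.pi ^ 2 * Real.sqrt Real.pi * Real.exp (-(3 : ℝ) / 2))) →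
    (∀ (M : Type) [TopologicalSpace M] [T2Space M] [SecondCountableTopology M] [ChartedSpace (EuclideanSpace ℝ (Fin 4)) M] [IsManifold (𝓡 4) ∞ M] [ConnectedSpace M] [NoncompactSpace M] [T3Space M] [MeasurableSpace M] [BorelSpace M]
      (g : Literature.Geometry.Lorentzian.PseudoRiemannianMetric (𝓡 4) ∞ (EuclideanSpace ℝ (Fin 4)) (TangentSpace (𝓡 4) : M → Type _)) [g.HasLeviCivita] (f : M → ℝ) (hg : g.IsRiemannian),
      (∀ (x : M) (r : NNReal), IsCompact {y : M | g.edist hg x y ≤ r}) → ContMDiff (𝓡 4) 𝓘(ℝ, ℝ) ∞ f →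
      (∀ (x : M) (X Y : TangentSpace (𝓡 4) x), g.ricci x X Y + g.hessian f x X Y = (1 / 2 : ℝ) * g.val x X Y) →
      (∀ x : M, g.scalarCurvature x + g.gradSq f x = f x) → (∃ x : M, g.scalarCurvature x ≠ 0) →
      ¬ (∃ c C : ℝ, 0 < c ∧ ∀ x : M, c ≤ g.scalarCurvature x ∧ g.scalarCurvature x ≤ C) →
      (∃ (X : Type) (_ : TopologicalSpace X) (_ : T2Space X) (_ : SecondCountableTopology X)
      (_ : ChartedSpace (EuclideanSpace ℝ (Fin 4)) X) (_ : IsManifold (𝓡 4) ∞ X) (_ : CompactSpace X),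
      Nonempty (X ≃ₕ (Metric.sphere (0 : EuclideanSpace ℝ (Fin 5)) 1)) ∧ ExhaustsInto M X) →
      ∫⁻ x, ENNReal.ofReal (Real.exp (-f x)) ∂(Literature.Geometry.Lorentzian.riemannianMeasure (g.toContMDiffRiemannianMetric hg)) ≤ ENNReal.ofReal (32 * Real.pi ^ 2 * Real.sqrt Real.pi * Real.exp (-(3 : ℝ) / 2))) →
    Summit.SmoothPoincare4.SmoothPoincare4.Theses.EntropyRung.CompactShrinkerGap →
    (∀ (N M : Type) [TopologicalSpace N] [T2Space N] [SecondCountableTopology N] [ChartedSpace (EuclideanSpace ℝ (Fin 4)) N] [IsManifold (𝓡 4) ∞ N] [CompactSpace N] [Nonempty N]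
      [TopologicalSpace M] [T2Space M] [SecondCountableTopology M] [ChartedSpace (EuclideanSpace ℝ (Fin 4)) M] [IsManifold (𝓡 4) ∞ M] [ConnectedSpace M]
      (φ : N → M), ContMDiff (𝓡 4) (𝓡 4) ∞ φ → Function.Injective φ →
      (∀ x : N, Function.Injective (mfderiv (𝓡 4) (𝓡 4) φ x)) →
      Nonempty (N ≃ₘ⟮𝓡 4, 𝓡 4⟯ M)) →
    Summit.SmoothPoincare4.SmoothPoincare4.Theses.EntropyRung.SubcylindricalRecognition

/-- **The composition is kernel-checked**: no sorry, no stub used. -/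
theorem composition_holds : Composition := by
  intro hDel hPin hRes hCpt hRec
  intro M _ _ _ _ _ _ _ _ _ e g _ hg hR hν
  -- `M ≃ₕ S⁴` ⇒ `M` path connected (tree), hence connected and non-empty.
  haveI := Literature.Topology.FourManifolds.pathConnectedSpace_sphere_four
  haveI : PathConnectedSpace M :=
    Literature.Topology.FourManifolds.pathConnectedSpace_of_homotopyEquiv e
  -- Extraction: a smooth complete non-flat normalised shrinker `N` above the cylinder density, exhausting into `M`.
  obtain ⟨N, _, _, _, _, _, _, _, _, _, gN, _, fN, hgN, hcpl, hf, hsol, hnorm, hnf, hdens, hexh⟩ :=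
    hDel M g hg hR hν
  by_cases hc : CompactSpace N
  · -- Compact model: the exhaustion map of `K = N` is an injective immersion `N → M`, hence a diffeomorphism.
    obtain ⟨φ, hφs, hφi, hφd⟩ :=
      hexh Set.univ isOpen_univ (by rw [closure_univ]; exact isCompact_univ)
    obtain ⟨Φ⟩ := hRec N M φ (contMDiffOn_univ.mp hφs) (Set.injOn_univ.mp hφi)
      (fun x => hφd x (Set.mem_univ x))
    -- `N ≃ₘ M ≃ₕ S⁴`, so route item #4 applies to the compact shrinker `(N, gN, fN)`.
    have eN : N ≃ₕ (Metric.sphere (0 : EuclideanSpace ℝ (Fin 5)) 1) := Φ.toHomeomorph.toHomotopyEquiv.trans e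
    obtain ⟨Ψ⟩ := hCpt N eN gN fN hgN hf hsol hnorm hdens
    exact ⟨Φ.symm.trans Ψ⟩
  · -- Non-compact model: pinched sector by the MW-class gap, the rest exhausts into the homotopy sphere `M`.
    haveI : NoncompactSpace N := not_compactSpace_iff.mp hc
    have hle : ∫⁻ x, ENNReal.ofReal (Real.exp (-fN x)) ∂(Literature.Geometry.Lorentzian.riemannianMeasure (gN.toContMDiffRiemannianMetric hgN)) ≤
        ENNReal.ofReal (32 * Real.pi ^ 2 * Real.sqrt Real.pi * Real.exp (-(3 : ℝ) / 2)) := by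
      by_cases hp : (∃ c C : ℝ, 0 < c ∧ ∀ x : N, c ≤ gN.scalarCurvature x ∧ gN.scalarCurvature x ≤ C)
      · exact hPin N gN fN hgN hcpl hf hsol hnorm hp
      · exact hRes N gN fN hgN hcpl hf hsol hnorm hnf hp
          ⟨M, inferInstance, inferInstance, inferInstance, inferInstance, inferInstance, inferInstance,
            ⟨e⟩, hexh⟩
    exact absurd hdens (not_lt.mpr hle)

/-- **SKELETON THEOREM (A12 shape): the line concludes the crux BY NAME**, using exactly the four declared stubs and the
registered route item #4 `EntropyRung.CompactShrinkerGap` (stmt-SmoothPoincare4-10870) as its only hypothesis. Its axiom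
closure is {propext, Classical.choice, Quot.sound, sorryAx} — the sorries being those of the stubs; it CLOSES the crux the
moment the four stubs and #4 are proved. -/
theorem SubcylindricalRecognition_of
    (hCpt : Summit.SmoothPoincare4.SmoothPoincare4.Theses.EntropyRung.CompactShrinkerGap) :
    Summit.SmoothPoincare4.SmoothPoincare4.Theses.EntropyRung.SubcylindricalRecognition :=
  composition_holds stub_modelDelivery stub_gapPinched stub_gapResidual hCpt stub_compactModelRecognition

/-! ## Certificates (sorry-free): the line is no harder than the route's own plan -/

/-- Route item #2 `NoncompactShrinkerGap` implies BOTH gap stubs (each only ADDS hypotheses to #2). -/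
theorem sectors_of_noncompactShrinkerGap :
    Summit.SmoothPoincare4.SmoothPoincare4.Theses.EntropyRung.NoncompactShrinkerGap →
    (∀ (M : Type) [TopologicalSpace M] [T2Space M] [SecondCountableTopology M] [ChartedSpace (EuclideanSpace ℝ (Fin 4)) M] [IsManifold (𝓡 4) ∞ M] [ConnectedSpace M] [NoncompactSpace M] [T3Space M] [MeasurableSpace M] [BorelSpace M]
      (g : Literature.Geometry.Lorentzian.PseudoRiemannianMetric (𝓡 4) ∞ (EuclideanSpace ℝ (Fin 4)) (TangentSpace (𝓡 4) : M → Type _)) [g.HasLeviCivita] (f : M → ℝ) (hg : g.IsRiemannian),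
      (∀ (x : M) (r : NNReal), IsCompact {y : M | g.edist hg x y ≤ r}) → ContMDiff (𝓡 4) 𝓘(ℝ, ℝ) ∞ f →
      (∀ (x : M) (X Y : TangentSpace (𝓡 4) x), g.ricci x X Y + g.hessian f x X Y = (1 / 2 : ℝ) * g.val x X Y) →
      (∀ x : M, g.scalarCurvature x + g.gradSq f x = f x) →
      (∃ c C : ℝ, 0 < c ∧ ∀ x : M, c ≤ g.scalarCurvature x ∧ g.scalarCurvature x ≤ C) →
      ∫⁻ x, ENNReal.ofReal (Real.exp (-f x)) ∂(Literature.Geometry.Lorentzian.riemannianMeasure (g.toContMDiffRiemannianMetric hg)) ≤ ENNReal.ofReal (32 * Real.pi ^ 2 * Real.sqrt Real.pi * Real.exp (-(3 : ℝ) / 2))) ∧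
    (∀ (M : Type) [TopologicalSpace M] [T2Space M] [SecondCountableTopology M] [ChartedSpace (EuclideanSpace ℝ (Fin 4)) M] [IsManifold (𝓡 4) ∞ M] [ConnectedSpace M] [NoncompactSpace M] [T3Space M] [MeasurableSpace M] [BorelSpace M]
      (g : Literature.Geometry.Lorentzian.PseudoRiemannianMetric (𝓡 4) ∞ (EuclideanSpace ℝ (Fin 4)) (TangentSpace (𝓡 4) : M → Type _)) [g.HasLeviCivita] (f : M → ℝ) (hg : g.IsRiemannian),
      (∀ (x : M) (r : NNReal), IsCompact {y : M | g.edist hg x y ≤ r}) → ContMDiff (𝓡 4) 𝓘(ℝ, ℝ) ∞ f →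
      (∀ (x : M) (X Y : TangentSpace (𝓡 4) x), g.ricci x X Y + g.hessian f x X Y = (1 / 2 : ℝ) * g.val x X Y) →
      (∀ x : M, g.scalarCurvature x + g.gradSq f x = f x) → (∃ x : M, g.scalarCurvature x ≠ 0) →
      ¬ (∃ c C : ℝ, 0 < c ∧ ∀ x : M, c ≤ g.scalarCurvature x ∧ g.scalarCurvature x ≤ C) →
      (∃ (X : Type) (_ : TopologicalSpace X) (_ : T2Space X) (_ : SecondCountableTopology X)
      (_ : ChartedSpace (EuclideanSpace ℝ (Fin 4)) X) (_ : IsManifold (𝓡 4) ∞ X) (_ : CompactSpace X),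
      Nonempty (X ≃ₕ (Metric.sphere (0 : EuclideanSpace ℝ (Fin 5)) 1)) ∧ ExhaustsInto M X) →
      ∫⁻ x, ENNReal.ofReal (Real.exp (-f x)) ∂(Literature.Geometry.Lorentzian.riemannianMeasure (g.toContMDiffRiemannianMetric hg)) ≤ ENNReal.ofReal (32 * Real.pi ^ 2 * Real.sqrt Real.pi * Real.exp (-(3 : ℝ) / 2))) := by
  intro h
  refine ⟨?_, ?_⟩
  · intro M _ _ _ _ _ _ _ _ _ _ g _ f hg hcpl hf hsol hnorm hp
    obtain ⟨c, C, hc, hcC⟩ := hp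
    obtain ⟨x⟩ := (inferInstance : Nonempty M)
    exact h M g f hg hcpl hf hsol hnorm ⟨x, ne_of_gt (lt_of_lt_of_le hc (hcC x).1)⟩
  · intro M _ _ _ _ _ _ _ _ _ _ g _ f hg hcpl hf hsol hnorm hnf _ _
    exact h M g f hg hcpl hf hsol hnorm hnf

/-- The two sectors reassemble the EMBEDDABLE non-compact gap of the idea card (`NoncompactShrinkerGap` + the single extra
hypothesis "exhausts into a homotopy 4-sphere"). -/
theorem embeddableGap_of_sectors :
    (∀ (M : Type) [TopologicalSpace M] [T2Space M] [SecondCountableTopology M] [ChartedSpace (EuclideanSpace ℝ (Fin 4)) M] [IsManifold (𝓡 4) ∞ M] [ConnectedSpace M] [NoncompactSpace M] [T3Space M] [MeasurableSpace M] [BorelSpace M]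
      (g : Literature.Geometry.Lorentzian.PseudoRiemannianMetric (𝓡 4) ∞ (EuclideanSpace ℝ (Fin 4)) (TangentSpace (𝓡 4) : M → Type _)) [g.HasLeviCivita] (f : M → ℝ) (hg : g.IsRiemannian),
      (∀ (x : M) (r : NNReal), IsCompact {y : M | g.edist hg x y ≤ r}) → ContMDiff (𝓡 4) 𝓘(ℝ, ℝ) ∞ f →
      (∀ (x : M) (X Y : TangentSpace (𝓡 4) x), g.ricci x X Y + g.hessian f x X Y = (1 / 2 : ℝ) * g.val x X Y) →
      (∀ x : M, g.scalarCurvature x + g.gradSq f x = f x) →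
      (∃ c C : ℝ, 0 < c ∧ ∀ x : M, c ≤ g.scalarCurvature x ∧ g.scalarCurvature x ≤ C) →
      ∫⁻ x, ENNReal.ofReal (Real.exp (-f x)) ∂(Literature.Geometry.Lorentzian.riemannianMeasure (g.toContMDiffRiemannianMetric hg)) ≤ ENNReal.ofReal (32 * Real.pi ^ 2 * Real.sqrt Real.pi * Real.exp (-(3 : ℝ) / 2))) →
    (∀ (M : Type) [TopologicalSpace M] [T2Space M] [SecondCountableTopology M] [ChartedSpace (EuclideanSpace ℝ (Fin 4)) M] [IsManifold (𝓡 4) ∞ M] [ConnectedSpace M] [NoncompactSpace M] [T3Space M] [MeasurableSpace M] [BorelSpace M]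
      (g : Literature.Geometry.Lorentzian.PseudoRiemannianMetric (𝓡 4) ∞ (EuclideanSpace ℝ (Fin 4)) (TangentSpace (𝓡 4) : M → Type _)) [g.HasLeviCivita] (f : M → ℝ) (hg : g.IsRiemannian),
      (∀ (x : M) (r : NNReal), IsCompact {y : M | g.edist hg x y ≤ r}) → ContMDiff (𝓡 4) 𝓘(ℝ, ℝ) ∞ f →
      (∀ (x : M) (X Y : TangentSpace (𝓡 4) x), g.ricci x X Y + g.hessian f x X Y = (1 / 2 : ℝ) * g.val x X Y) →
      (∀ x : M, g.scalarCurvature x + g.gradSq f x = f x) → (∃ x : M, g.scalarCurvature x ≠ 0) →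
      ¬ (∃ c C : ℝ, 0 < c ∧ ∀ x : M, c ≤ g.scalarCurvature x ∧ g.scalarCurvature x ≤ C) →
      (∃ (X : Type) (_ : TopologicalSpace X) (_ : T2Space X) (_ : SecondCountableTopology X)
      (_ : ChartedSpace (EuclideanSpace ℝ (Fin 4)) X) (_ : IsManifold (𝓡 4) ∞ X) (_ : CompactSpace X),
      Nonempty (X ≃ₕ (Metric.sphere (0 : EuclideanSpace ℝ (Fin 5)) 1)) ∧ ExhaustsInto M X) →
      ∫⁻ x, ENNReal.ofReal (Real.exp (-f x)) ∂(Literature.Geometry.Lorentzian.riemannianMeasure (g.toContMDiffRiemannianMetric hg)) ≤ ENNReal.ofReal (32 * Real.pi ^ 2 * Real.sqrt Real.pi * Real.exp (-(3 : ℝ) / 2))) →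
    (∀ (M : Type) [TopologicalSpace M] [T2Space M] [SecondCountableTopology M] [ChartedSpace (EuclideanSpace ℝ (Fin 4)) M] [IsManifold (𝓡 4) ∞ M] [ConnectedSpace M] [NoncompactSpace M] [T3Space M] [MeasurableSpace M] [BorelSpace M]
      (g : Literature.Geometry.Lorentzian.PseudoRiemannianMetric (𝓡 4) ∞ (EuclideanSpace ℝ (Fin 4)) (TangentSpace (𝓡 4) : M → Type _)) [g.HasLeviCivita] (f : M → ℝ) (hg : g.IsRiemannian),
      (∀ (x : M) (r : NNReal), IsCompact {y : M | g.edist hg x y ≤ r}) → ContMDiff (𝓡 4) 𝓘(ℝ, ℝ) ∞ f →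
      (∀ (x : M) (X Y : TangentSpace (𝓡 4) x), g.ricci x X Y + g.hessian f x X Y = (1 / 2 : ℝ) * g.val x X Y) →
      (∀ x : M, g.scalarCurvature x + g.gradSq f x = f x) → (∃ x : M, g.scalarCurvature x ≠ 0) →
      (∃ (X : Type) (_ : TopologicalSpace X) (_ : T2Space X) (_ : SecondCountableTopology X)
      (_ : ChartedSpace (EuclideanSpace ℝ (Fin 4)) X) (_ : IsManifold (𝓡 4) ∞ X) (_ : CompactSpace X),
      Nonempty (X ≃ₕ (Metric.sphere (0 : EuclideanSpace ℝ (Fin 5)) 1)) ∧ ExhaustsInto M X) →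
      ∫⁻ x, ENNReal.ofReal (Real.exp (-f x)) ∂(Literature.Geometry.Lorentzian.riemannianMeasure (g.toContMDiffRiemannianMetric hg)) ≤ ENNReal.ofReal (32 * Real.pi ^ 2 * Real.sqrt Real.pi * Real.exp (-(3 : ℝ) / 2))) := by
  intro hPin hRes M _ _ _ _ _ _ _ _ _ _ g _ f hg hcpl hf hsol hnorm hnf hX
  by_cases hp : (∃ c C : ℝ, 0 < c ∧ ∀ x : M, c ≤ g.scalarCurvature x ∧ g.scalarCurvature x ≤ C)
  · exact hPin M g f hg hcpl hf hsol hnorm hp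
  · exact hRes M g f hg hcpl hf hsol hnorm hnf hp hX

/-- The route's own dependency set runs through the same composition: extraction ∧ #2 ∧ #4 ∧ compact-model recognition
⇒ RUNG (hypothesis form, sorry-free). [folklore] -/
@[folklore] def RouteComposition : Prop :=
    (∀ (M : Type) [TopologicalSpace M] [T2Space M] [SecondCountableTopology M] [ChartedSpace (EuclideanSpace ℝ (Fin 4)) M] [IsManifold (𝓡 4) ∞ M] [CompactSpace M] [ConnectedSpace M] [T3Space M] [MeasurableSpace M] [BorelSpace M]
      (g : Literature.Geometry.Lorentzian.PseudoRiemannianMetric (𝓡 4) ∞ (EuclideanSpace ℝ (Fin 4)) (TangentSpace (𝓡 4) : M → Type _)) [g.HasLeviCivita] (hg : g.IsRiemannian),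
      (∀ x : M, 0 < g.scalarCurvature x) →
      (∃ δ : ℝ, 0 < δ ∧ ∀ τ : ℝ, 0 < τ → ∀ f : M → ℝ, ContMDiff (𝓡 4) 𝓘(ℝ, ℝ) ∞ f → ∫ x, (4 * Real.pi * τ) ^ (-(4 : ℝ) / 2) * Real.exp (-f x) ∂(Literature.Geometry.Lorentzian.riemannianMeasure (g.toContMDiffRiemannianMetric hg)) = 1 → Real.log 2 + Real.log Real.pi / 2 - 3 / 2 + δ ≤ ∫ x, (τ * (g.scalarCurvature x + g.gradSq f x) + f x - 4) * ((4 * Real.pi * τ) ^ (-(4 : ℝ) / 2) * Real.exp (-f x)) ∂(Literature.Geometry.Lorentzian.riemannianMeasure (g.toContMDiffRiemannianMetric hg))) →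
      ∃ (N : Type) (_ : TopologicalSpace N) (_ : T2Space N) (_ : SecondCountableTopology N)
      (_ : ChartedSpace (EuclideanSpace ℝ (Fin 4)) N) (_ : IsManifold (𝓡 4) ∞ N) (_ : ConnectedSpace N)
      (_ : T3Space N) (_ : MeasurableSpace N) (_ : BorelSpace N)
      (gN : Literature.Geometry.Lorentzian.PseudoRiemannianMetric (𝓡 4) ∞ (EuclideanSpace ℝ (Fin 4)) (TangentSpace (𝓡 4) : N → Type _)) (_ : gN.HasLeviCivita) (fN : N → ℝ) (hgN : gN.IsRiemannian),
      (∀ (x : N) (r : NNReal), IsCompact {y : N | gN.edist hgN x y ≤ r}) ∧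
      ContMDiff (𝓡 4) 𝓘(ℝ, ℝ) ∞ fN ∧
      (∀ (x : N) (X Y : TangentSpace (𝓡 4) x), gN.ricci x X Y + gN.hessian fN x X Y = (1 / 2 : ℝ) * gN.val x X Y) ∧
      (∀ x : N, gN.scalarCurvature x + gN.gradSq fN x = fN x) ∧
      (∃ x : N, gN.scalarCurvature x ≠ 0) ∧
      ENNReal.ofReal (32 * Real.pi ^ 2 * Real.sqrt Real.pi * Real.exp (-(3 : ℝ) / 2)) < ∫⁻ x, ENNReal.ofReal (Real.exp (-fN x)) ∂(Literature.Geometry.Lorentzian.riemannianMeasure (gN.toContMDiffRiemannianMetric hgN)) ∧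
      ExhaustsInto N M) →
    Summit.SmoothPoincare4.SmoothPoincare4.Theses.EntropyRung.NoncompactShrinkerGap →
    Summit.SmoothPoincare4.SmoothPoincare4.Theses.EntropyRung.CompactShrinkerGap →
    (∀ (N M : Type) [TopologicalSpace N] [T2Space N] [SecondCountableTopology N] [ChartedSpace (EuclideanSpace ℝ (Fin 4)) N] [IsManifold (𝓡 4) ∞ N] [CompactSpace N] [Nonempty N]
      [TopologicalSpace M] [T2Space M] [SecondCountableTopology M] [ChartedSpace (EuclideanSpace ℝ (Fin 4)) M] [IsManifold (𝓡 4) ∞ M] [ConnectedSpace M]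
      (φ : N → M), ContMDiff (𝓡 4) (𝓡 4) ∞ φ → Function.Injective φ →
      (∀ x : N, Function.Injective (mfderiv (𝓡 4) (𝓡 4) φ x)) →
      Nonempty (N ≃ₘ⟮𝓡 4, 𝓡 4⟯ M)) →
    Summit.SmoothPoincare4.SmoothPoincare4.Theses.EntropyRung.SubcylindricalRecognition

/-- `RouteComposition` holds (sorry-free). -/
theorem routeComposition_holds : RouteComposition :=
  fun hDel h2 h4 hRec =>
    composition_holds hDel (sectors_of_noncompactShrinkerGap h2).1 (sectors_of_noncompactShrinkerGap h2).2 h4 hRec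

end Summit.SmoothPoincare4.SmoothPoincare4.Cruxes.SubcylindricalRecognition.SpinelessModels
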